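import Summits.QuantumAdvantage.AdviceFreeQNC0.Elimination
import HarnessLib

/-!
# Cell qa-qnc0 — the elimination game, II: the log-degree lower bound and class rotation

Sequel to `Elimination.lean` (planner qa-qnc0-p2's residue-elimination game, E2
`elimCorr_identity`):

* `corrMod3_le_exp` — Viola–Wigderson for the cube with `ζ = ζ₃` (tree
  `GowersCube.violaWigderson_cube_exp_bound`, `Re ζ₃^{2^d} = −1/2`): `C(q) ≤ exp(−(3/2)n/4^{d+1})`
  for `q` of degree `≤ d`;
* `elimLogDegreeBound` (p2's `ElimLogDegreeBound`, `β = 3/2`): eliminators of `𝔽₂`-degree `≤ d`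
  fail on at least `(1/3 − (3/2)(e^{−(3/2)n/4^{d+1}} + 2⁻ⁿ))·2ⁿ` inputs — UNCONDITIONAL, non-trivial
  for `d ≤ (1/2 − ε) log₂ n`;
* `elimFailBits_rotate` / `elimFailCount_rotate` / `elimFailCount_lower_bound_all_classes` —
  multiplying `E` by `ω` moves the target class by one and preserves degree, so class-`0` lower
  bounds (p2's "`c = 0` w.l.o.g.") hold for every class `c`.

WHAT THIS IS NOT: nothing at polylog degree (`ElimConst`/`CorrMod3`, open).
-/

noncomputable section

open Finset
open scoped ComplexConjugate

open Literature.Computability.MetaComplexity Literature.Computability.MetaComplexity.Smolensky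
open Literature.Computability.MetaComplexity.GowersCube

namespace Summit.QuantumAdvantage.AdviceFreeQNC0

variable {n : ℕ}

/-! ### The log-degree lower bound (E2 + Viola–Wigderson) -/

/-- Viola–Wigderson for the cube with `ζ = ζ₃`: `C(q) ≤ exp(−(3/2)·n/4^{d+1})` for `q` of degree
`≤ d` (tree `GowersCube.violaWigderson_cube_exp_bound`, `Re ζ₃^{2^d} = −1/2`). -/
theorem corrMod3_le_exp {d : ℕ} {q : (Fin n → Bool) → Bool} (hq : HasDeg q d) :
    corrMod3 q ≤ Real.exp (-(3 / 2 * n / 4 ^ (d + 1))) := by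
  have h := violaWigderson_cube_exp_bound hq zeta3_norm
  rw [zeta3_two_pow_re] at h
  have hC : corrMod3 q = ‖(∑ x : Fin n → Bool, signChar (if q x then (1 : ZMod 2) else 0) *
      zeta3 ^ (univ.filter fun i => x i = true).card) / 2 ^ n‖ := by
    unfold corrMod3 wt
    congr 2
    refine Finset.sum_congr rfl fun u _ => ?_
    cases q u <;> simp
  rw [hC]
  refine h.trans (le_of_eq ?_)
  norm_num

/-- `HasDeg` is closed under `xor` (the `𝔽₂`-indicator of `a ⊕ b` is the sum of the indicators). -/
theorem hasDeg_xor {d : ℕ} {a b : (Fin n → Bool) → Bool} (ha : HasDeg a d) (hb : HasDeg b d) :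
    HasDeg (fun u => xor (a u) (b u)) d := by
  unfold HasDeg at *
  have key : ∀ p q : Bool, (if (xor p q) = true then (1 : ZMod 2) else 0) =
      (if p = true then (1 : ZMod 2) else 0) + (if q = true then (1 : ZMod 2) else 0) := by decide
  have h : (fun x => if (xor (a x) (b x)) = true then (1 : ZMod 2) else 0) =
      (fun x => if a x = true then (1 : ZMod 2) else 0) + (fun x => if b x = true then (1 : ZMod 2) else 0) := by
    funext x
    simp only [Pi.add_apply]
    exact key (a x) (b x)
  rw [h]
  exact Submodule.add_mem _ ha hb

/-- **`ElimLogDegreeBound`** (planner qa-qnc0-p2's typed statement, with `β = 3/2`): eliminators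
of `𝔽₂`-degree `≤ d` fail on at least `(1/3 − (3/2)(e^{−(3/2)n/4^{d+1}} + 2⁻ⁿ))·2ⁿ` inputs —
unconditional, non-trivial for `d ≤ (1/2 − ε) log₂ n`. -/
theorem elimLogDegreeBound : ∃ β : ℝ, 0 < β ∧ ∀ n d : ℕ, ∀ a b : (Fin n → Bool) → Bool,
    HasDeg a d → HasDeg b d →
      (1 / 3 - 3 / 2 * (Real.exp (-(β * n / 4 ^ (d + 1))) + 1 / 2 ^ n)) * 2 ^ n ≤
        (elimFailCount 0 a b : ℝ) := by
  refine ⟨3 / 2, by norm_num, fun n d a b ha hb => ?_⟩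
  have h2n : (0 : ℝ) < 2 ^ n := by positivity
  have hE := elimCorr_identity 0 a b
  set M := max (corrMod3 a) (max (corrMod3 b) (corrMod3 fun u => xor (a u) (b u))) with hM
  have hMle : M ≤ Real.exp (-(3 / 2 * n / 4 ^ (d + 1))) := by
    refine max_le (corrMod3_le_exp ha) (max_le (corrMod3_le_exp hb) (corrMod3_le_exp (hasDeg_xor ha hb)))
  have hp00 : (0 : ℝ) ≤ 2 / 3 * ((p00 a b : ℝ) / 2 ^ n) := by positivity
  have hlow : 1 / 3 - (M + 1 / 2 ^ n) ≤ (elimFailCount 0 a b : ℝ) / 2 ^ n := by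
    have := (abs_le.1 hE).1
    linarith
  rw [← le_div_iff₀ h2n]
  refine le_trans ?_ hlow
  have h1 : (0 : ℝ) ≤ 1 / 2 ^ n := by positivity
  have hexp : 0 < Real.exp (-(3 / 2 * n / 4 ^ (d + 1))) := Real.exp_pos _
  nlinarith

/-! ### Changing the target class: multiplication by `ω` (p2: "`c = 0` w.l.o.g.") -/

/-- **Rotation**: `ω·(a + ωb) = b + ω(a ⊕ b)` in `𝔽₄`, so the eliminator `(b, a ⊕ b)` fails for
target class `c + 1` exactly where `(a, b)` fails for class `c` (pointwise). -/
theorem elimFailBits_rotate (c : ℕ) (α β : Bool) (w : ℕ) :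
    elimFailBits (c + 1) β (xor α β) w = elimFailBits c α β w := by
  unfold elimFailBits
  have hc : c % 3 < 3 := Nat.mod_lt _ (by norm_num)
  have hw : w % 3 < 3 := Nat.mod_lt _ (by norm_num)
  have hc1 : (c + 1) % 3 = (c % 3 + 1) % 3 := by omega
  rw [hc1]
  interval_cases hcm : c % 3 <;> interval_cases hwm : w % 3 <;> cases α <;> cases β <;> decide

/-- The rotated eliminator has the same failure count for the next class. -/
theorem elimFailCount_rotate (c : ℕ) (a b : (Fin n → Bool) → Bool) :
    elimFailCount (c + 1) b (fun u => xor (a u) (b u)) = elimFailCount c a b := by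
  unfold elimFailCount elimFail
  congr 1
  ext u
  simp only [mem_filter, mem_univ, true_and, elimFailBits_rotate]

/-- Hence class-`0` lower bounds for degree-`≤ d` eliminators hold for EVERY target class
(the rotation preserves `HasDeg`, `hasDeg_xor`): if every degree-`≤ d` pair fails at least `m`
times for class `c`, the same holds for class `c + 1`, and so for all classes by induction. -/
theorem elimFailCount_lower_bound_all_classes {d m : ℕ}
    (h : ∀ a b : (Fin n → Bool) → Bool, HasDeg a d → HasDeg b d → m ≤ elimFailCount 0 a b) :
    ∀ (c : ℕ) (a b : (Fin n → Bool) → Bool), HasDeg a d → HasDeg b d → m ≤ elimFailCount c a b := by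
  intro c
  induction c with
  | zero => exact h
  | succ c ih =>
    intro a b ha hb
    -- `(a, b)` for class `c+1` is the rotation of `(a ⊕ b, a)` for class `c`
    have hrot := elimFailCount_rotate (n := n) c (fun u => xor (a u) (b u)) a
    have hfun : (fun u => xor (xor (a u) (b u)) (a u)) = b := by
      funext u; cases a u <;> cases b u <;> rfl
    rw [hfun] at hrot
    rw [hrot]
    exact ih _ _ (hasDeg_xor ha hb) ha

end Summit.QuantumAdvantage.AdviceFreeQNC0
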